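import Summits.CriticalPhenomena.PercolationContinuityZ3.Theorems.Transplant.PlanarSkeletonFrmFromDefs
import Summits.CriticalPhenomena.PercolationContinuityZ3.Theorems.Transplant.SkelFrmFromBChoiceRegionsYVR
import Summits.CriticalPhenomena.PercolationContinuityZ3.Theorems.Transplant.SkelFrmBChoiceRegionsYVR
import Summits.CriticalPhenomena.PercolationContinuityZ3.Theorems.Transplant.SkelFrmBChoiceCreepYCore3S
import HarnessLib
import Summits.CriticalPhenomena.PercolationContinuityZ3.Theorems.Transplant.SkelFrmBChoiceArrivalYVR
/-!
# U-WAVE PORT (RULING D-U, lead g21 2026-08-26; WAVE-U-MANIFEST v3.0 row «SkelFrmBChoiceArrivalYVR» ↦ «SkelFrmFromBChoiceArrivalYVR») of the tree module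
# `Transplant/SkelFrmBChoiceArrivalYVR` onto the carrier `PlanarSkeletonFrmFrom` (frames only, cylinders connected from width `ℓ₀` on)

ORIGINAL TITLE: N2 (frames-only node `SamePDropOfSkeletonFrm₁`, OPEN) — (ζ″) at the (R-45) instance of record: THE y′-ARRIVAL BOX IN THE ROOM-FIELD FORM p5-g16's V

builds on p205010 (kernel theorem, internal audit signed; external expert review pending) — nothing in this file uses p205010; NOTHING is claimed about the
OPEN node U `SamePDropOfSkeletonFrmFrom₁` (nor U_s / the end state).  Lane `prim-bschramm`, seat `prim-hp-8 gen 53 (U-wave port pen, family P-hp8; tool of record = p3-g26 port_u.py)`; helper file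
(`--supports stmt-CriticalPhenomena-4575 --as helper`).  PORT RULES r1–r4 of RULING D-U: declaration order and proof texts are those of the original,
byte-identical except (i) the carrier token `PlanarSkeletonFrm ↦ PlanarSkeletonFrmFrom` (binders, `namespace`/`end` lines, qualified names of twinned
declarations), (ii) carrier-FREE declarations of the original (φ-level `Skelφ…` blocks and namespace-only arithmetic residents) are NOT re-declared —
this file imports the original and `export`s the twin-free residents (POLICY T / treatment (m1)); residents whose statement mentions a twinned
constant are copied, (iii) every carrier-binding declaration keeps its explicit binder `(Φ : PlanarSkeletonFrmFrom G)` in its own signature (r2).  Docstrings and citations are the original's.  Manifest row idx 191 (level 20; flags verbatim); filed by the hp-8 lineage under RULING M-11 (family P-hp8); hidden-dependency repairs: extra twin imports -; re-pointing opens ['--open-extra', 'PlanarSkeletonFrm.NegB=creepY_core3_sumlo,floorA_bounds'] (M-4).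
-/

open scoped Classical

noncomputable section

namespace Summit.CriticalPhenomena.PercolationContinuityZ3.Theorems.Transplant

namespace PlanarSkeletonFrmFrom

open PlanarSkeletonFrm.NegB (creepY_core3_sumlo floorA_bounds)

namespace NegB

open Literature.Probability.Percolation Literature.Probability.LatticeModels SimpleGraph
open Literature.Probability.Percolation.KozmaNitzan.Cells (oth)
open SkelConc (Consts)
open Skelφ (shearUnit kgSL kgSLY kgM₁Y kgM₂Y kgE₁Y kgXY kgCtr2Y kgHw2Y kgA₁Yp kgT₁Y kgTY kgDec₁Y kgDec₂Y dS rdLo rdHi KGYRows)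
open TwoAxis.Para (modulus)
open Neg

section CreepY

variable (κ : Consts) {V : Type} [DecidableEq V] [Countable V] {G : SimpleGraph V} [G.LocallyFinite] (Φ : PlanarSkeletonFrmFrom G) (t : V) (p : unitInterval)
  (D : Skelφ.StepI.DataNS V) (g f mk : ℕ)

/- The tuple's atoms as hygiene-free local notations (they expand syntactically at each use; importers see the expanded terms). -/
set_option hygiene false in local notation "NYᵣ" => kgNYv0 κ Φ t p D g f mk (qxYQ4 κ Φ t p D g f) (WxYQ4 κ Φ t p D g f)
set_option hygiene false in local notation "qYᵣ" => kgqY κ Φ t p D g f (qxYQ4 κ Φ t p D g f)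
set_option hygiene false in local notation "WYᵣ" => kgWY κ Φ t p D g f (WxYQ4 κ Φ t p D g f)
set_option hygiene false in local notation "Rᵣ" => kgR κ Φ t p D mk
set_option hygiene false in local notation "nᵣ" => nL κ Φ t p D g f
set_option hygiene false in local notation "ℓᵣ" => ℓL κ Φ t p D g f
set_option hygiene false in local notation "hᵣ" => hL κ Φ t p D g f
set_option hygiene false in local notation "vᵣ" => vL κ Φ t p D g f
set_option hygiene false in local notation "Uᵣ" => shearUnit (nL κ Φ t p D g f) (hL κ Φ t p D g f)
set_option hygiene false in local notation "Δᵣ" => modulus (nL κ Φ t p D g f) (hL κ Φ t p D g f) (vL κ Φ t p D g f) (vβL κ Φ t p D g f)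
set_option hygiene false in local notation "sLᵣ" => kgSL (nL κ Φ t p D g f) (ℓL κ Φ t p D g f) (hL κ Φ t p D g f)
set_option hygiene false in local notation "s0ᵣ" => (((fcellsA κ Φ t p D g f).s 0 : ℕ) : ℤ)
set_option hygiene false in local notation "r0ᵣ" => (((fcellsA κ Φ t p D g f).r 0 : ℕ) : ℤ)
set_option hygiene false in local notation "Kᵣ" => ((Neg.K κ : ℕ) : ℤ)
set_option hygiene false in local notation "LOᵣ" => rdLo (Aof κ) (nL κ Φ t p D g f) (hL κ Φ t p D g f) (vL κ Φ t p D g f) (vβL κ Φ t p D g f) (prFA κ Φ t p D g f).c₀ (prFA κ Φ t p D g f).c₁ (prFA κ Φ t p D g f).D (arrLoY3 κ Φ t p D g f mk) (arrHiY3 κ Φ t p D g f mk) 0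
set_option hygiene false in local notation "HIᵣ" => rdHi (Aof κ) (nL κ Φ t p D g f) (hL κ Φ t p D g f) (vL κ Φ t p D g f) (vβL κ Φ t p D g f) (prFA κ Φ t p D g f).c₀ (prFA κ Φ t p D g f).c₁ (prFA κ Φ t p D g f).D (arrLoY3 κ Φ t p D g f mk) (arrHiY3 κ Φ t p D g f mk) 0
set_option hygiene false in local notation "s1ᵣ" => (((fcellsA κ Φ t p D g f).s 1 : ℕ) : ℤ)
set_option hygiene false in local notation "r1ᵣ" => (((fcellsA κ Φ t p D g f).r 1 : ℕ) : ℤ)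
set_option hygiene false in local notation "LO1ᵣ" => rdLo (Aof κ) (nL κ Φ t p D g f) (hL κ Φ t p D g f) (vL κ Φ t p D g f) (vβL κ Φ t p D g f) (prFA κ Φ t p D g f).c₀ (prFA κ Φ t p D g f).c₁ (prFA κ Φ t p D g f).D (arrLoY3 κ Φ t p D g f mk) (arrHiY3 κ Φ t p D g f mk) 1
set_option hygiene false in local notation "HI1ᵣ" => rdHi (Aof κ) (nL κ Φ t p D g f) (hL κ Φ t p D g f) (vL κ Φ t p D g f) (vβL κ Φ t p D g f) (prFA κ Φ t p D g f).c₀ (prFA κ Φ t p D g f).c₁ (prFA κ Φ t p D g f).D (arrLoY3 κ Φ t p D g f mk) (arrHiY3 κ Φ t p D g f mk) 1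

/-- **THE y′-ARRIVAL READING's TRUE SUM AND WIDTH** at the tuple: `139·s₀ ≤ LO + HI`, `HI − LO ≤ 93·s₀ + 2` (`creepY_core3_sumlo`). [this work] -/
theorem arrY3_sum_width (κ : Consts) {V : Type} [DecidableEq V] [Countable V] {G : SimpleGraph V} [G.LocallyFinite] (Φ : PlanarSkeletonFrmFrom G) (t : V) (p : unitInterval) (D : Skelφ.StepI.DataNS V) (g : ℕ) (f : ℕ) (mk : ℕ) (hKq : 5 ≤ Neg.Kq κ) (hN : EqNumL κ Φ t p D g f) (hg : gFloorKG κ Φ t p D mk ≤ g) (hg2 : 40 * Neg.K κ * KS0.R'0 κ Φ t p D mk ≤ g) :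
    139 * s0ᵣ ≤ LOᵣ + HIᵣ ∧ HIᵣ - LOᵣ ≤ 93 * s0ᵣ + 2 := by
  -- the tuple's facts
  obtain ⟨hsc0, -, hn1, hA0, hDp, hm, -, -, hkq, -⟩ := hsc_Q κ Φ t p D g f hN
  obtain ⟨hnR', hs40, hbig, hR1, -, -⟩ := valsQ_floor κ Φ t p D g f mk hN hg hg2
  have hUs := UsL_le_modulus κ Φ t p D g f hN
  have hNle : ((NYᵣ : ℕ) : ℤ) ≤ 21 * Kᵣ + 2 := by exact_mod_cast kgNYv0_le κ Φ t p D g f mk (qxYQ4 κ Φ t p D g f) (WxYQ4 κ Φ t p D g f) hN hg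
  have H := kgYRows0_of κ Φ t p D g f mk (qxYQ4 κ Φ t p D g f) (WxYQ4 κ Φ t p D g f) hN hg
  obtain ⟨-, hE2, hE3⟩ := H.kgE₁Y_spec NYᵣ
  have hv := hN.v_le
  have hd1eq := (dec₁Y_eq_Q κ Φ t p D g f mk).1
  obtain ⟨ha1lo, ha1hi⟩ := a1Y_bounds_3 κ Φ t p D g f mk hKq hN hg hg2 NYᵣ hNle
  obtain ⟨ha2lo, ha2hi⟩ := a2Y_le_3 κ Φ t p D g f mk hKq hN hg hg2 NYᵣ hNle
  obtain ⟨hXY0, hXYle⟩ := XY_le_3 κ Φ t p D g f mk hKq hN hg hg2 NYᵣ hNle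
  have hCeq := kgCtr2Y_eq_zero H NYᵣ
  have hHeq := kgHw2Y_eq_zero nᵣ ℓᵣ hᵣ vᵣ Rᵣ qYᵣ WYᵣ NYᵣ
  have hP0 := kgSL_le_natDiv κ Φ t p D g f hN
  have hP1 := Skelφ.natDiv_le_kgSLY hn1 ℓᵣ hᵣ
  have hP0nat : ((nᵣ * ℓᵣ / Uᵣ : ℕ) : ℤ) = ((nᵣ : ℕ) : ℤ) * ℓᵣ / (Uᵣ : ℕ) := by push_cast; rfl
  rw [hP0nat] at hP0 hP1
  rw [kgSLY_eq_kgSL] at hP1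
  have h80 : 80 ≤ Neg.K κ := by have := Neg.K_eq κ; omega
  have hK80 : (80 : ℤ) ≤ Kᵣ := by exact_mod_cast h80
  have hRR : ((KS0.R'0 κ Φ t p D mk : ℕ) : ℤ) = ((Rᵣ : ℕ) : ℤ) := rfl
  rw [hRR] at hnR' hR1 hs40
  have hR0 : (0 : ℤ) ≤ ((Rᵣ : ℕ) : ℤ) := by linarith
  have hn0 : (0 : ℤ) < ((nᵣ : ℕ) : ℤ) := by exact_mod_cast hn1
  have hn1z : (1 : ℤ) ≤ ((nᵣ : ℕ) : ℤ) := by exact_mod_cast hn1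
  have hA1 : 1 ≤ Aof κ := by linarith
  have hs0one : (1 : ℤ) ≤ s0ᵣ := by exact_mod_cast (fcellsA κ Φ t p D g f).hs 0
  have hs0p : (0 : ℤ) < s0ᵣ := by linarith
  -- `Δ ≤ nℓ ≤ U·sL + 2U − 2`, `n ≤ U`
  have hmod := (Skelφ.NegPrm.modulus_vβOf hn1 hᵣ ℓᵣ vᵣ).2
  have hvβ : vβL κ Φ t p D g f = Skelφ.NegPrm.vβOf nᵣ hᵣ ℓᵣ vᵣ := rfl
  rw [← hvβ] at hmod
  have hU : (0 : ℤ) < (Uᵣ : ℕ) := Skelφ.shearUnit_pos hn1 _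
  have hUn : ((nᵣ : ℕ) : ℤ) ≤ (Uᵣ : ℕ) := by rw [shearUnit_cast]; linarith [abs_nonneg hᵣ]
  have hΔU : Δᵣ ≤ ((Uᵣ : ℕ) : ℤ) * sLᵣ + 2 * ((Uᵣ : ℕ) : ℤ) := by
    have hfl := Int.lt_mul_ediv_self_add (x := ((nᵣ : ℕ) : ℤ) * ℓᵣ - (Uᵣ : ℕ) + 1) hU
    unfold Skelφ.kgSL; linarith
  -- `c₀′·A·Δ = s₀·D`
  have hr0 : r0ᵣ = 40 * ((Neg.Kq κ : ℕ) : ℤ) * s0ᵣ := by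
    rw [PCells2.r_eq, show ((fcellsA κ Φ t p D g f).K : ℤ) = Neg.K κ by exact_mod_cast (fcellsA_K κ Φ t p D g f).1,
      show Kᵣ = 40 * ((Neg.Kq κ : ℕ) : ℤ) by exact_mod_cast Neg.K_eq κ]
  have e0 : (prFA κ Φ t p D g f).c₀ * Aof κ * Δᵣ = s0ᵣ * (prFA κ Φ t p D g f).D := by
    rw [hr0] at hsc0
    have h' : (40 * ((Neg.Kq κ : ℕ) : ℤ)) * ((prFA κ Φ t p D g f).c₀ * Aof κ * Δᵣ) = (40 * ((Neg.Kq κ : ℕ) : ℤ)) * (s0ᵣ * (prFA κ Φ t p D g f).D) := by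
      linear_combination hsc0
    have h40 : (40 * ((Neg.Kq κ : ℕ) : ℤ)) ≠ 0 := by positivity
    exact mul_left_cancel₀ h40 h'
  -- the box rows and the `/2` facts
  obtain ⟨elo0, ehi0, elo1, ehi1⟩ := arrY3_apply κ Φ t p D g f mk
  have hbox : kgCtr2Y nᵣ vᵣ Rᵣ 0 WYᵣ NYᵣ - kgHw2Y nᵣ ℓᵣ hᵣ vᵣ Rᵣ 0 qYᵣ WYᵣ NYᵣ ≤ 2 * arrLoY3 κ Φ t p D g f mk 0 ∧ 2 * arrLoY3 κ Φ t p D g f mk 0 ≤ kgCtr2Y nᵣ vᵣ Rᵣ 0 WYᵣ NYᵣ - kgHw2Y nᵣ ℓᵣ hᵣ vᵣ Rᵣ 0 qYᵣ WYᵣ NYᵣ + 1 ∧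
      2 * arrHiY3 κ Φ t p D g f mk 0 ≤ kgCtr2Y nᵣ vᵣ Rᵣ 0 WYᵣ NYᵣ + kgHw2Y nᵣ ℓᵣ hᵣ vᵣ Rᵣ 0 qYᵣ WYᵣ NYᵣ ∧ kgCtr2Y nᵣ vᵣ Rᵣ 0 WYᵣ NYᵣ + kgHw2Y nᵣ ℓᵣ hᵣ vᵣ Rᵣ 0 qYᵣ WYᵣ NYᵣ - 1 ≤ 2 * arrHiY3 κ Φ t p D g f mk 0 := by
    rw [elo0, ehi0]; omega
  have hlo1 : arrLoY3 κ Φ t p D g f mk 1 = (((NYᵣ : ℕ) : ℤ) + 1) * sLᵣ + kgXY nᵣ ℓᵣ hᵣ vᵣ Rᵣ 0 qYᵣ WYᵣ NYᵣ - ((nᵣ : ℕ) : ℤ) * ℓᵣ / (Uᵣ : ℕ) := by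
    rw [elo1, kgSLY_eq_kgSL]; push_cast; ring
  have hT2 : vᵣ * (((Uᵣ : ℕ) : ℤ) * arrHiY3 κ Φ t p D g f mk 1 + ((Uᵣ : ℕ) : ℤ) - 1) = vᵣ * (((Uᵣ : ℕ) : ℤ) * arrLoY3 κ Φ t p D g f mk 1) + vᵣ * (((Uᵣ : ℕ) : ℤ) * (((nᵣ : ℕ) : ℤ) * ℓᵣ / (Uᵣ : ℕ)) + ((Uᵣ : ℕ) : ℤ) - 1) := by
    rw [ehi1, elo1]; push_cast; ring
  -- the readings as nested floors
  simp only [Skelφ.rdLo_zero, Skelφ.rdHi_zero]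
  set Zm := (Δᵣ * arrLoY3 κ Φ t p D g f mk 0 - max (vᵣ * (((Uᵣ : ℕ) : ℤ) * arrLoY3 κ Φ t p D g f mk 1)) (vᵣ * (((Uᵣ : ℕ) : ℤ) * arrHiY3 κ Φ t p D g f mk 1 + ((Uᵣ : ℕ) : ℤ) - 1))) with hZm
  set Zp := (Δᵣ * arrHiY3 κ Φ t p D g f mk 0 - min (vᵣ * (((Uᵣ : ℕ) : ℤ) * arrLoY3 κ Φ t p D g f mk 1)) (vᵣ * (((Uᵣ : ℕ) : ℤ) * arrHiY3 κ Φ t p D g f mk 1 + ((Uᵣ : ℕ) : ℤ) - 1))) with hZp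
  have hqm := Int.mul_ediv_self_le (x := Aof κ * Zm) (ne_of_gt hn0)
  have hqm' := Int.lt_mul_ediv_self_add (x := Aof κ * Zm) hn0
  have hqp := Int.mul_ediv_self_le (x := Aof κ * Zp) (ne_of_gt hn0)
  have hqp' := Int.lt_mul_ediv_self_add (x := Aof κ * Zp) hn0
  have hFm := Int.mul_ediv_self_le (x := (prFA κ Φ t p D g f).c₀ * (Aof κ * Zm / ((nᵣ : ℕ) : ℤ))) (ne_of_gt hDp)
  have hFm' := Int.lt_mul_ediv_self_add (x := (prFA κ Φ t p D g f).c₀ * (Aof κ * Zm / ((nᵣ : ℕ) : ℤ))) hDp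
  have hFp := Int.mul_ediv_self_le (x := (prFA κ Φ t p D g f).c₀ * (Aof κ * Zp / ((nᵣ : ℕ) : ℤ))) (ne_of_gt hDp)
  have hFp' := Int.lt_mul_ediv_self_add (x := (prFA κ Φ t p D g f).c₀ * (Aof κ * Zp / ((nᵣ : ℕ) : ℤ))) hDp
  obtain ⟨hF1, hF2⟩ := floorA_bounds hA1 hn0 hm hs0p hDp e0 hqm hqm' hFm hFm'
  obtain ⟨hF3, hF4⟩ := floorA_bounds hA1 hn0 hm hs0p hDp e0 hqp hqp' hFp hFp'
  have hE5 : ((kgE₁Y nᵣ vᵣ Rᵣ 0 WYᵣ NYᵣ : ℕ) : ℤ) ≤ 5 * ((nᵣ : ℕ) : ℤ) := by linarith [abs_nonneg vᵣ]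
  have hsum := creepY_core3_sumlo (hn := hn1z) (hUn := hUn) (hUs := hUs) (hΔU := hΔU) (hs := hbig) (hK := hK80) (hR := hR1) (hKR := hs40) (hnR := hnR')
    (hav0 := abs_nonneg _) (havn := hv) (hv1 := le_abs_self _) (hv2 := neg_le_abs _) (hN0 := Nat.cast_nonneg _) (hN := hNle)
    (ha1 := ha1lo) (ha1' := ha1hi) (ha2 := ha2lo) (ha2' := ha2hi) (hE0 := hE2) (hE1 := hE5) (hXY0 := hXY0) (hXY := hXYle)
    (hP0 := hP0) (hP1 := hP1) (hH := hHeq) (hC := hCeq) (hlo0 := hbox.1) (hlo0' := hbox.2.1) (hhi0 := hbox.2.2.1) (hhi0' := hbox.2.2.2)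
    (hlo1 := hlo1) (hG := rfl) (hT₁ := rfl) (hT₂ := hT2) (hAm := hZm) (hAp := hZp) (hs0 := hs0one) (hF2 := hF2) (hF3 := hF3) (hF4 := hF4)
  exact ⟨by linarith [hsum.1], by linarith [hsum.2]⟩

/-- **THE y′-ARRIVAL BOX IN ROOM-FIELD FORM** (p5's `hLt` twin at V): `−hB 1 ≤ rdLo₀(arrival)` and `rdHi₀(arrival) ≤ hF 1` for the cells
`fcellsV … c (hFRv … mk)` (`hB 1 = 2r₀`, `hF 1 = cRvY3 + 54·s₀ + 2`; any creep value `c`). [this work] -/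
theorem hLtY_V' (κ : Consts) {V : Type} [DecidableEq V] [Countable V] {G : SimpleGraph V} [G.LocallyFinite] (Φ : PlanarSkeletonFrmFrom G) (t : V) (p : unitInterval) (D : Skelφ.StepI.DataNS V) (g : ℕ) (f : ℕ) (mk : ℕ) (c : Fin 2 → ℕ) (hKq : 5 ≤ Neg.Kq κ) (hN : EqNumL κ Φ t p D g f) (hg : gFloorKG κ Φ t p D mk ≤ g) (hg2 : 40 * Neg.K κ * KS0.R'0 κ Φ t p D mk ≤ g) :
    -(((fcellsV κ Φ t p D g f c (hFRv κ Φ t p D g f mk)).hB 1 : ℕ) : ℤ) ≤ LOᵣ ∧ HIᵣ ≤ (((fcellsV κ Φ t p D g f c (hFRv κ Φ t p D g f mk)).hF 1 : ℕ) : ℤ) := by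
  obtain ⟨hs, hw⟩ := arrY3_sum_width κ Φ t p D g f mk hKq hN hg hg2
  obtain ⟨-, -, hlo, -⟩ := hLtY_3 κ Φ t p D g f mk hKq hN hg hg2
  obtain ⟨hc, -⟩ := cRvY3_eq κ Φ t p D g f mk hKq hN hg hg2
  have hs0 : (1 : ℤ) ≤ s0ᵣ := by exact_mod_cast (fcellsA κ Φ t p D g f).hs 0
  constructor
  · rw [fcellsV_hB, show oth (1 : Fin 2) = 0 by decide]; push_cast; linarith
  · rw [fcellsV_hF_eq_hFRv κ Φ t p D g f mk c hKq hN hg hg2 1, (hFRv_apply κ Φ t p D g f mk).2]; push_cast; rw [hc]; unfold cmidY3; omega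

end CreepY

end NegB

end PlanarSkeletonFrmFrom

end Summit.CriticalPhenomena.PercolationContinuityZ3.Theorems.Transplant

end
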